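import Mathlib
import Summits.Ventures.PercRepro2.Defs
import Summits.Ventures.PercRepro2.Graph
import Summits.Ventures.PercRepro2.Events
import Summits.Ventures.PercRepro2.Harris
import Summits.Ventures.PercRepro2.XWForm

/-!
# The dominated-pair strengthening of (XW) fails at five vertices (PercRepro2, p2 g24)

(XW-DOM) (P2-G23-XW.md §6): for independent `X ∼ P_p`, `Y ∼ P_q` with `p ≤ q` coordinatewise,
`E[(1 − S_X S_Y)(a_X − a_Y)(λ_X − λ_Y)] ≥ 0`, i.e. `B_W(p, q) + B_W(q, p) ≥ 0` (`xwBil`); its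
extreme case is `X` on `G − C`, `Y` on `G / C` with common weights off `C`.  It is FALSE at five
vertices: on `g5 = {s–y, y–o, y–v, o–v, s–v, u–v}` (`s, y, o, u, v = 0, 1, 2, 3, 4`) with the
weights `½, ⅔, ¾, 5/12` on the first four edges and the pinned pair `C = {s–v, u–v}`
(`p0`: closed, `p1`: open), **`xwBil_dom_witness`**: `B_W(p0, p1) + B_W(p1, p0) = −25/13824`,
hence **`xwdom_fails`**.  Exact rational arithmetic in the kernel: connectivity on `g5` by a
lookup table identified with `Conn g5` (`conn_iff_tab`, by `ReflTransGen` induction over decided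
lemmas), every probability a decided `64`-term sum (`prob_eq_tab`).  (XW) itself and its
one-pinned-edge form (XW-MIX1) survive on every graph with `≤ 5` vertices (`XWKFive.lean`) resp.
by census.  Own work; standard axioms.
-/

namespace Summit.Ventures.PercRepro2

namespace XWDomCex

/-! ## The graph and its connectivity table -/

/-- The witness graph on `Fin 5`: edges `0 = 01, 1 = 12, 2 = 14, 3 = 24, 4 = 04, 5 = 34`
(marks `s = 0, y = 1, o = 2, u = 3`; `v = 4`). -/
def g5 : Fin 6 → Sym2 (Fin 5) := ![s(0, 1), s(1, 2), s(1, 4), s(2, 4), s(0, 4), s(3, 4)]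

/-- The index of the edge between two vertices (`6`, out of range, for non-edges). -/
def edgeIdx (u v : Fin 5) : ℕ :=
  match u, v with
  | 0, 1 => 0 | 1, 0 => 0
  | 1, 2 => 1 | 2, 1 => 1
  | 1, 4 => 2 | 4, 1 => 2
  | 2, 4 => 3 | 4, 2 => 3
  | 0, 4 => 4 | 4, 0 => 4
  | 3, 4 => 5 | 4, 3 => 5
  | _, _ => 6

/-- The state of the edge between `u` and `v` in the bit pattern `X`. -/
def edgeBit (X : ℕ) (u v : Fin 5) : Bool := X.testBit (edgeIdx u v)

/-- The connectivity table: the base-`2^25` digit `X` is the `25`-bit mask of the pairs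
`(u, v)` (bit `5u + v`) connected in the configuration with bit pattern `X`. -/
def connTabN : ℕ :=
  44462416477094044620016814065517364315819234512137839259496346213500316044593345549313094938312916192542626838355897587846871773525350426750933308662785165493886905804909118799320813025433578784595334944187526635394019046060557838567030374582335093250752753012222742240958381571806675885020346394379449246019002381569641373136179682606917608071833930093568972642134907464598188829645745586460599312199434854806526946881834977018002178671676089524957015280686423810017748313948033089

/-- The connectivity mask of the bit pattern `X`. -/
def connTab (X : ℕ) : ℕ := (connTabN / 2 ^ (25 * X)) % 33554432

/-- Connectivity by table lookup. -/
def tabBit (X : ℕ) (u v : Fin 5) : Bool := (connTab X).testBit (5 * u.val + v.val)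

/-- The configuration with the bits of `k`. -/
def cfg (k : ℕ) : Config (Fin 6) := fun e => k.testBit e.val

/-- The bit encoding of a configuration. -/
def enc (ω : Config (Fin 6)) : ℕ := ∑ e : Fin 6, if ω e then 2 ^ e.val else 0

/-- `cfg` inverts `enc`. -/
lemma cfg_enc : ∀ ω : Config (Fin 6), cfg (enc ω) = ω := by
  decide +kernel

/-- `enc` inverts `cfg` below `64`. -/
lemma enc_cfg : ∀ k < 64, enc (cfg k) = k := by
  decide +kernel

/-- The encoding is below `64`. -/
lemma enc_lt : ∀ ω : Config (Fin 6), enc ω < 64 := by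
  decide +kernel

/-- The configurations are the bit patterns of `Fin 64`. -/
def cfgEquiv : Fin 64 ≃ Config (Fin 6) where
  toFun k := cfg k.val
  invFun ω := ⟨enc ω, enc_lt ω⟩
  left_inv k := Fin.ext (enc_cfg k.val k.isLt)
  right_inv ω := cfg_enc ω

/-- An open edge between `u` and `v` is an open-adjacency witness. -/
lemma exists_of_edgeBit : ∀ (ω : Config (Fin 6)) (u v : Fin 5), edgeBit (enc ω) u v = true →
    ∃ e : Fin 6, ω e = true ∧ g5 e = s(u, v) := by
  decide +kernel

/-- An open-adjacency witness is an open edge. -/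
lemma edgeBit_of_exists : ∀ (ω : Config (Fin 6)) (u v : Fin 5),
    (∃ e : Fin 6, ω e = true ∧ g5 e = s(u, v)) → edgeBit (enc ω) u v = true := by
  decide +kernel

/-- The table is reflexive. -/
lemma tab_refl : ∀ X < 64, ∀ u : Fin 5, tabBit X u u = true := by
  decide +kernel

/-- The table absorbs an open edge at the end. -/
lemma tab_tail : ∀ X < 64, ∀ u v w : Fin 5,
    tabBit X u v = true → edgeBit X v w = true → tabBit X u w = true := by
  decide +kernel

/-- An open path of length `≤ 4` between `u` and `v`, as a Boolean. -/
def pathB (X : ℕ) (u v : Fin 5) : Bool :=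
  decide (u = v) || edgeBit X u v ||
    (List.finRange 5).any (fun a => edgeBit X u a && edgeBit X a v) ||
    (List.finRange 5).any (fun a => (List.finRange 5).any (fun b =>
      edgeBit X u a && edgeBit X a b && edgeBit X b v)) ||
    (List.finRange 5).any (fun a => (List.finRange 5).any (fun b => (List.finRange 5).any
      (fun c => edgeBit X u a && edgeBit X a b && edgeBit X b c && edgeBit X c v)))

/-- A table connection is an open path of length `≤ 4`. -/
lemma tab_path : ∀ X < 64, ∀ u v : Fin 5, tabBit X u v = true → pathB X u v = true := by
  decide +kernel

/-- `pathB` unfolds to the existence of an open path of length `≤ 4`. -/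
lemma pathB_spec {X : ℕ} {u v : Fin 5} (h : pathB X u v = true) :
    u = v ∨ edgeBit X u v = true ∨ (∃ a, edgeBit X u a = true ∧ edgeBit X a v = true) ∨
      (∃ a b, edgeBit X u a = true ∧ edgeBit X a b = true ∧ edgeBit X b v = true) ∨
      ∃ a b c, edgeBit X u a = true ∧ edgeBit X a b = true ∧ edgeBit X b c = true ∧
        edgeBit X c v = true := by
  simp only [pathB, Bool.or_eq_true, decide_eq_true_eq, List.any_eq_true, List.mem_finRange,
    true_and, Bool.and_eq_true, and_assoc] at h
  rcases h with (((h | h) | ⟨a, h1, h2⟩) | ⟨a, b, h1, h2, h3⟩) | ⟨a, b, c, h1, h2, h3, h4⟩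
  · exact Or.inl h
  · exact Or.inr (Or.inl h)
  · exact Or.inr (Or.inr (Or.inl ⟨a, h1, h2⟩))
  · exact Or.inr (Or.inr (Or.inr (Or.inl ⟨a, b, h1, h2, h3⟩)))
  · exact Or.inr (Or.inr (Or.inr (Or.inr ⟨a, b, c, h1, h2, h3, h4⟩)))

/-- An open edge connects. -/
lemma conn_of_edgeBit {ω : Config (Fin 6)} {u v : Fin 5} (h : edgeBit (enc ω) u v = true) :
    Conn g5 ω u v := by
  obtain ⟨e, he, hk⟩ := exists_of_edgeBit ω u v h
  exact conn_of_openAdj ⟨e, he, hk⟩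

/-- **The table is connectivity on `g5`.** -/
theorem conn_iff_tab (ω : Config (Fin 6)) (u v : Fin 5) :
    Conn g5 ω u v ↔ tabBit (enc ω) u v = true := by
  constructor
  · intro h
    unfold Conn at h
    rw [SimpleGraph.reachable_iff_reflTransGen] at h
    induction h with
    | refl => exact tab_refl (enc ω) (enc_lt ω) u
    | tail _ hadj ih =>
      rw [openGraph_adj] at hadj
      exact tab_tail (enc ω) (enc_lt ω) _ _ _ ih (edgeBit_of_exists ω _ _ hadj.2)
  · intro h
    rcases pathB_spec (tab_path (enc ω) (enc_lt ω) u v h) with rfl | h | ⟨a, h1, h2⟩ |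
      ⟨a, b, h1, h2, h3⟩ | ⟨a, b, c, h1, h2, h3, h4⟩
    · exact conn_refl g5 ω u
    · exact conn_of_edgeBit h
    · exact conn_trans (conn_of_edgeBit h1) (conn_of_edgeBit h2)
    · exact conn_trans (conn_of_edgeBit h1) (conn_trans (conn_of_edgeBit h2) (conn_of_edgeBit h3))
    · exact conn_trans (conn_of_edgeBit h1) (conn_trans (conn_of_edgeBit h2)
        (conn_trans (conn_of_edgeBit h3) (conn_of_edgeBit h4)))

/-- Connectivity of a configuration, as a Boolean. -/
def connB (ω : Config (Fin 6)) (u v : Fin 5) : Bool := tabBit (enc ω) u v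

/-- Membership in a connection event, as a Boolean. -/
lemma mem_connEvent_iff (ω : Config (Fin 6)) (u v : Fin 5) :
    ω ∈ connEvent g5 u v ↔ connB ω u v = true :=
  conn_iff_tab ω u v

/-! ## Probabilities as decided sums -/

/-- A probability whose event is recognised by a Boolean is a sum over the bit patterns. -/
lemma prob_eq_tab (p : Fin 6 → ℚ) (A : Set (Config (Fin 6))) (b : Config (Fin 6) → Bool)
    (hb : ∀ ω, ω ∈ A ↔ b ω = true) :
    prob p A = ∑ j ∈ Finset.range 64, if b (cfg j) then weight p (cfg j) else 0 := by
  unfold prob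
  rw [Finset.sum_range (fun j => if b (cfg j) then weight p (cfg j) else 0),
    ← Fintype.sum_equiv cfgEquiv (fun k => if b (cfg k.val) then weight p (cfg k.val) else 0)
      (fun ω => A.indicator (weight p) ω) (fun k => ?_)]
  simp only [cfgEquiv, Equiv.coe_fn_mk]
  by_cases hA : cfg k.val ∈ A
  · rw [Set.indicator_of_mem hA, if_pos ((hb _).1 hA)]
  · rw [Set.indicator_of_notMem hA, if_neg (fun h => hA ((hb _).2 h))]

/-- Membership in an intersection of two connection events, as a Boolean. -/
lemma mem_inter2_iff (ω : Config (Fin 6)) (a b c d : Fin 5) :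
    ω ∈ connEvent g5 a b ∩ connEvent g5 c d ↔ (connB ω a b && connB ω c d) = true := by
  simp only [Set.mem_inter_iff, mem_connEvent_iff, Bool.and_eq_true]

/-- Membership in an intersection of three connection events, as a Boolean. -/
lemma mem_inter3_iff (ω : Config (Fin 6)) (a b c d e f : Fin 5) :
    ω ∈ connEvent g5 a b ∩ connEvent g5 c d ∩ connEvent g5 e f ↔
      (connB ω a b && connB ω c d && connB ω e f) = true := by
  simp only [Set.mem_inter_iff, mem_connEvent_iff, Bool.and_eq_true]

/-- `B_W(p, q)` as decided sums. -/
def bw (p q : Fin 6 → ℚ) : ℚ :=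
  (∑ j ∈ Finset.range 64, if (connB (cfg j) 0 3 && connB (cfg j) 1 2) then weight p (cfg j)
      else 0) +
    (∑ j ∈ Finset.range 64, if (connB (cfg j) 0 1 && connB (cfg j) 0 3) then weight p (cfg j)
      else 0) *
      (∑ j ∈ Finset.range 64, if (connB (cfg j) 0 1 && connB (cfg j) 1 2) then weight q (cfg j)
        else 0) -
    (∑ j ∈ Finset.range 64, if connB (cfg j) 0 3 then weight p (cfg j) else 0) *
      (∑ j ∈ Finset.range 64, if connB (cfg j) 1 2 then weight q (cfg j) else 0) -
    (∑ j ∈ Finset.range 64, if connB (cfg j) 0 1 then weight p (cfg j) else 0) *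
      (∑ j ∈ Finset.range 64,
        if (connB (cfg j) 0 1 && connB (cfg j) 0 3 && connB (cfg j) 1 2) then weight q (cfg j)
        else 0)

/-- `xwBil` at the marks `0, 1, 2, 3` is `bw`. -/
lemma xwBil_eq_bw (p q : Fin 6 → ℚ) : xwBil g5 0 1 2 3 p q = bw p q := by
  unfold xwBil bw
  rw [prob_eq_tab p _ _ (mem_inter2_iff · 0 3 1 2), prob_eq_tab p _ _ (mem_inter2_iff · 0 1 0 3),
    prob_eq_tab q _ _ (mem_inter2_iff · 0 1 1 2), prob_eq_tab p _ _ (mem_connEvent_iff · 0 3),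
    prob_eq_tab q _ _ (mem_connEvent_iff · 1 2), prob_eq_tab p _ _ (mem_connEvent_iff · 0 1),
    prob_eq_tab q _ _ (mem_inter3_iff · 0 1 0 3 1 2)]

/-! ## The witness -/

/-- The weights with the pinned pair `s–v, u–v` CLOSED. -/
def p0 : Fin 6 → ℚ := ![1/2, 2/3, 3/4, 5/12, 0, 0]

/-- The weights with the pinned pair `s–v, u–v` OPEN. -/
def p1 : Fin 6 → ℚ := ![1/2, 2/3, 3/4, 5/12, 1, 1]

/-- `p0 ≤ p1` coordinatewise. -/
lemma p0_le_p1 : ∀ e, p0 e ≤ p1 e := by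
  decide +kernel

/-- Both weight vectors are admissible. -/
lemma isProbVec_p0 : IsProbVec p0 where
  nonneg e := by fin_cases e <;> norm_num [p0]
  le_one e := by fin_cases e <;> norm_num [p0]

/-- Both weight vectors are admissible. -/
lemma isProbVec_p1 : IsProbVec p1 where
  nonneg e := by fin_cases e <;> norm_num [p1]
  le_one e := by fin_cases e <;> norm_num [p1]

set_option maxHeartbeats 0 in
set_option maxRecDepth 100000 in
/-- **The decided value**: `B_W(p0, p1) + B_W(p1, p0) = −25/13824`. -/
lemma bw_witness : bw p0 p1 + bw p1 p0 = -25 / 13824 := by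
  decide +kernel

/-- **(XW-DOM) fails on `g5`**: `B_W(p0, p1) + B_W(p1, p0) = −25/13824 < 0` for the dominated
pair `p0 ≤ p1`. -/
theorem xwBil_dom_witness : xwBil g5 0 1 2 3 p0 p1 + xwBil g5 0 1 2 3 p1 p0 = -25 / 13824 := by
  rw [xwBil_eq_bw, xwBil_eq_bw, bw_witness]

/-- **(XW-DOM) is false**: there are admissible `p ≤ q` with `B_W(p, q) + B_W(q, p) < 0`. -/
theorem xwdom_fails : ¬ (∀ p q : Fin 6 → ℚ, IsProbVec p → IsProbVec q → (∀ e, p e ≤ q e) →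
    0 ≤ xwBil g5 0 1 2 3 p q + xwBil g5 0 1 2 3 q p) := by
  intro h
  have := h p0 p1 isProbVec_p0 isProbVec_p1 p0_le_p1
  rw [xwBil_dom_witness] at this
  norm_num at this

end XWDomCex

end Summit.Ventures.PercRepro2
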